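import Summits.CriticalPhenomena.PercolationContinuityZ3.Theorems.PercNearOneGluingNoHeavyLowerTailThreePartitionCubeDict
import Summits.CriticalPhenomena.PercolationContinuityZ3.Theorems.PercNearOneGluingNoHeavyLowerTailThreePartitionCubeSymA

/-!
# Twisted three-partition positivity (★★) = (M⁺-3) on SIX letters: soundness of the checker, IX — **the FILTERS are implied by the pair
# conditions** (class sizes vs. the chain bound, the minimal-element filter), and `passes`

Support file (cell `prim-sahi`, seat `prim-sahi-typer` gen 34; `--supports stmt-CriticalPhenomena-4575`).  Pure; no `sorry`, standard axioms.
For a coloured node `(pts, mm)` representing a conditioned pair `(A, B)` (`Repr`, file VIII) the checker discards the colouring only when it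
cannot be a `PairSat.PairCond` pair:
* `card_coGen_eq_countBelow` — the class sizes `k1, k2` of `colourStep` are `|coGen A|, |coGen B|`;
* **`card_le_cbOf`** — every antichain of free points has at most `cbOf m pts = chainBound …` elements, PROVIDED the classes of `chainId` are
  chains (`ChainIdOK m`, a finite check supplied for `m = 6` by the final file): distinct elements of an antichain lie in distinct chains;
* `testBit_sub_two_pow`, `testBit_upShift`, **`mem_minEl_of_testBit_minMask`** — a set bit of `minMask T (encA A)` is a minimal element of
  `A` (`PairSat.mem_minEl_iff_sdiff_singleton`); `testBit_upNOf_iff`; **`filter₂_eq_zero`** — for a conditioned pair the minimal-element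
  filter word vanishes (`PairCond.minA/minB`: a minimal element of one up-set lying in the other is free, hence above no point of the node);
* `passes_of` — the four facts give `passes … = true`. [this work]
-/

namespace Summit.CriticalPhenomena.PercolationContinuityZ3.Theorems.ThreePartition.Cube

open Finset SahiGridPattern.Pair43 SahiC3Cube
open scoped Classical symmDiff

variable {m : ℕ}

/-! ### Counting -/

/-- **The class sizes of a represented pair** (distinct codes): `|coGen A| = k1`, `|coGen B| = n - k1`. [this work] -/
theorem card_coGen_eq_countBelow {A B : Finset (Set (Fin m))} {pts : Array ℕ} {mm : ℕ} (hR : Repr m A B pts mm)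
    (hinj : ∀ j < pts.size, ∀ j' < pts.size, pts.getD j 0 = pts.getD j' 0 → j = j') :
    (PairSat.coGen A).card = countBelow pts.size (fun j => inFirst mm j) ∧
      (PairSat.coGen B).card = pts.size - countBelow pts.size (fun j => inFirst mm j) := by
  have hinj' : Set.InjOn (fun j => pt m (pts.getD j 0)) ↑(range pts.size) := by
    intro j hj j' hj' h
    rw [coe_range, Set.mem_Iio] at hj hj'
    exact hinj j hj j' hj' (eq_of_pt_eq (hR.lt j hj) (hR.lt j' hj') h)
  have hA : PairSat.coGen A = ((range pts.size).filter fun j => inFirst mm j = true).image fun j => pt m (pts.getD j 0) := by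
    ext a; rw [hR.cls1, mem_image]
    constructor
    · rintro ⟨j, hj, hf, h⟩; exact ⟨j, mem_filter.2 ⟨mem_range.2 hj, hf⟩, h⟩
    · rintro ⟨j, hj, h⟩; exact ⟨j, mem_range.1 (mem_filter.1 hj).1, (mem_filter.1 hj).2, h⟩
  have hB : PairSat.coGen B = ((range pts.size).filter fun j => ¬ inFirst mm j = true).image fun j => pt m (pts.getD j 0) := by
    ext b; rw [hR.cls2, mem_image]
    constructor
    · rintro ⟨j, hj, hf, h⟩; exact ⟨j, mem_filter.2 ⟨mem_range.2 hj, by rw [hf]; exact Bool.false_ne_true⟩, h⟩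
    · rintro ⟨j, hj, h⟩
      exact ⟨j, mem_range.1 (mem_filter.1 hj).1, by simpa using (mem_filter.1 hj).2, h⟩
  rw [hA, hB, card_image_of_injOn (hinj'.mono (by intro j hj; exact (mem_filter.1 hj).1)),
    card_image_of_injOn (hinj'.mono (by intro j hj; exact (mem_filter.1 hj).1)), countBelow_eq_card]
  refine ⟨rfl, ?_⟩
  have := card_filter_add_card_filter_not (s := range pts.size) (fun j => inFirst mm j = true)
  rw [card_range] at this
  omega

/-! ### The chain bound -/

/-- `ChainIdOK m`: the classes of the table `chainId` are chains of codes, and the ids are `< 2^m` (a finite check; `m = 6` in the final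
file). [this work] -/
def ChainIdOK (m : ℕ) : Prop :=
  (∀ a < 2 ^ m, ∀ b < 2 ^ m, (mkTabs m).chainId.getD a 0 = (mkTabs m).chainId.getD b 0 → sub a b = true ∨ sub b a = true) ∧
    ∀ a < 2 ^ m, (mkTabs m).chainId.getD a 0 < 2 ^ m

/-- Bits of the word of chain ids met by a mask. [this work] -/
theorem testBit_chainIds (T : Tabs) (free c : ℕ) :
    (foldBelow T.np (fun a acc => if free.testBit a then acc ||| (1 <<< T.chainId.getD a 0) else acc) 0).testBit c =
      (List.range T.np).any fun a => free.testBit a && decide (T.chainId.getD a 0 = c) := by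
  induction T.np with
  | zero => simp [foldBelow]
  | succ n ih =>
    rw [foldBelow, List.range_succ, List.any_append, List.any_cons, List.any_nil, Bool.or_false, ← ih]
    by_cases h : free.testBit n = true
    · rw [if_pos h, Nat.testBit_or, Nat.one_shiftLeft, Nat.testBit_two_pow, h, Bool.true_and]
    · rw [if_neg h]; simp [h]

/-- **THE CHAIN BOUND**: an antichain of free points has at most `cbOf m pts` elements (given `ChainIdOK m`). [this work] -/
theorem card_le_cbOf (hC : ChainIdOK m) (pts : Array ℕ) (Qf : Finset (Set (Fin m))) (hQa : IsAntichain (· ≤ ·) (Qf : Set (Set (Fin m))))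
    (hQfree : ∀ q ∈ Qf, (freeOf m pts).testBit (encS q) = true) : Qf.card ≤ cbOf m pts := by
  unfold cbOf chainBound
  rw [pc_eq_card]
  refine card_le_card_of_injOn (fun q => (mkTabs m).chainId.getD (encS q) 0) (fun q hq => ?_) (fun q hq q' hq' h => ?_)
  · rw [mem_coe, mem_filter, mem_range, testBit_chainIds, np_eq, List.any_eq_true]
    refine ⟨hC.2 _ (encS_lt q), encS q, List.mem_range.2 (encS_lt q), ?_⟩
    rw [hQfree q hq, Bool.true_and, decide_eq_true rfl]
  · rw [mem_coe] at hq hq'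
    by_contra hne
    rcases hC.1 _ (encS_lt q) _ (encS_lt q') h with hs | hs
    · rw [sub_eq_true_iff _ (encS_lt q), pt_encS, pt_encS] at hs
      exact hQa hq hq' hne hs
    · rw [sub_eq_true_iff _ (encS_lt q'), pt_encS, pt_encS] at hs
      exact hQa hq' hq (Ne.symm hne) hs

/-! ### Minimal elements -/

/-- Bits of `y - 2^i` when bit `i` of `y` is set: bit `i` is cleared, the others are kept. [this work] -/
theorem testBit_sub_two_pow {y i : ℕ} (h : y.testBit i = true) (j : ℕ) : (y - 2 ^ i).testBit j = (y.testBit j && decide (j ≠ i)) := by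
  have hy : y = 2 ^ (i + 1) * (y / 2 ^ (i + 1)) + y % 2 ^ (i + 1) := (Nat.div_add_mod y (2 ^ (i + 1))).symm
  set a := y / 2 ^ (i + 1)
  set b := y % 2 ^ (i + 1)
  have hb : b < 2 ^ (i + 1) := Nat.mod_lt _ (by positivity)
  have hbi : b.testBit i = true := by
    have h1 := Nat.testBit_two_pow_mul_add a hb i
    rw [← hy, if_pos (Nat.lt_succ_self i)] at h1
    rw [← h1]; exact h
  have hbge : 2 ^ i ≤ b := Nat.ge_two_pow_of_testBit hbi
  have hpow : 2 ^ (i + 1) = 2 * 2 ^ i := by rw [Nat.pow_succ]; ring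
  set c := b - 2 ^ i
  have hc : c < 2 ^ i := by omega
  have hbc : b = 2 ^ i * 1 + c := by omega
  have hy' : y - 2 ^ i = 2 ^ (i + 1) * a + c := by omega
  rw [hy', Nat.testBit_two_pow_mul_add a (hc.trans (by omega)) j]
  conv_rhs => rw [hy, Nat.testBit_two_pow_mul_add a hb j, hbc, Nat.two_pow_add_eq_or_of_lt hc, Nat.testBit_or, Nat.mul_one,
    Nat.testBit_two_pow]
  by_cases hj : j < i + 1
  · rw [if_pos hj, if_pos hj]
    by_cases hji : j = i
    · subst hji; simp [Nat.testBit_lt_two_pow hc]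
    · have : i ≠ j := Ne.symm hji
      simp [hji, this]
  · rw [if_neg hj, if_neg hj]
    have hji : j ≠ i := by omega
    simp [hji]

/-- The point of `y - 2^i` (bit `i` set) is the point of `y` minus the coordinate `i`. [this work] -/
theorem pt_sub_two_pow {y i : ℕ} (h : y.testBit i = true) (hi : i < m) : pt m (y - 2 ^ i) = pt m y \ {(⟨i, hi⟩ : Fin m)} := by
  ext k
  simp only [pt, Set.mem_setOf_eq, Set.mem_sdiff, Set.mem_singleton_iff, testBit_sub_two_pow h, Bool.and_eq_true, decide_eq_true_eq]
  constructor
  · rintro ⟨h1, h2⟩; exact ⟨h1, fun hk => h2 (by rw [hk])⟩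
  · rintro ⟨h1, h2⟩; exact ⟨h1, fun hk => h2 (Fin.ext hk)⟩

/-- Bits of `upShift`, uniform statement (the fold only). [this work] -/
theorem testBit_upShift' (U y : ℕ) :
    (upShift (mkTabs m) U).testBit y =
      (List.range m).any fun i => decide (y ≥ 2 ^ i) && (U.testBit (y - 2 ^ i) && ((mkTabs m).noBit.getD i 0).testBit (y - 2 ^ i)) := by
  unfold upShift
  show (foldBelow m _ 0).testBit y = _
  suffices hs : ∀ k : ℕ, (foldBelow k (fun i acc => acc ||| ((U &&& (mkTabs m).noBit.getD i 0) <<< (1 <<< i))) 0).testBit y =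
      (List.range k).any fun i => decide (y ≥ 2 ^ i) && (U.testBit (y - 2 ^ i) && ((mkTabs m).noBit.getD i 0).testBit (y - 2 ^ i)) from hs m
  intro k
  induction k with
  | zero => simp [foldBelow]
  | succ k ihk =>
    rw [foldBelow, Nat.testBit_or, ihk, List.range_succ, List.any_append, List.any_cons, List.any_nil, Bool.or_false, Nat.one_shiftLeft,
      Nat.testBit_shiftLeft, Nat.testBit_land]

/-- **A set bit of `minMask T (encA A)` is a minimal element of the up-set `A`.** [this work] -/
theorem mem_minEl_of_testBit_minMask {A : Finset (Set (Fin m))} (hA : IsUpperSet (A : Set (Set (Fin m)))) {y : ℕ} (hy : y < 2 ^ m)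
    (h : (minMask (mkTabs m) (encA m ↑A)).testBit y = true) : pt m y ∈ PairSat.minEl A := by
  unfold minMask at h
  rw [Nat.testBit_xor, Nat.testBit_land] at h
  have hU : (encA m (↑A : Set (Set (Fin m)))).testBit y = true := by
    cases hb : (encA m (↑A : Set (Set (Fin m)))).testBit y
    · rw [hb] at h; simp at h
    · rfl
  rw [hU, Bool.true_and] at h
  have hup : (upShift (mkTabs m) (encA m ↑A)).testBit y = false := by simpa using h
  rw [testBit_upShift', List.any_eq_false] at hup
  have hyA : pt m y ∈ A := by
    have := hU; rw [testBit_encA_of_lt _ hy] at this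
    exact @of_decide_eq_true _ (Classical.propDecidable _) this
  rw [PairSat.mem_minEl_iff_sdiff_singleton hA]
  refine ⟨hyA, fun i hi hmem => ?_⟩
  have hbit : y.testBit i.val = true := hi
  have hge : y ≥ 2 ^ i.val := Nat.ge_two_pow_of_testBit hbit
  have hlt' : y - 2 ^ i.val < 2 ^ m := lt_of_le_of_lt (Nat.sub_le _ _) hy
  have h1 := hup i.val (List.mem_range.2 i.isLt)
  rw [decide_eq_true hge, Bool.true_and, testBit_noBit m i.isLt, decide_eq_true hlt', Bool.true_and, testBit_sub_two_pow hbit i.val]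
    at h1
  simp only [ne_eq, not_true_eq_false, decide_false, Bool.and_false, Bool.not_false, Bool.and_true] at h1
  rw [testBit_encA_of_lt _ hlt', pt_sub_two_pow hbit i.isLt] at h1
  exact h1 (@decide_eq_true _ (Classical.propDecidable _) hmem)

/-- Bits of `upNOf` (codes `< 2^m`): above some point of the node. [this work] -/
theorem testBit_upNOf_iff {pts : Array ℕ} (hpts : PtsLt m pts) {y : ℕ} (hy : y < 2 ^ m) :
    (upNOf m pts).testBit y = true ↔ ∃ j < pts.size, pt m (pts.getD j 0) ⊆ pt m y := by
  unfold upNOf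
  rw [orTab_eq_pair43, testBit_orTab, List.any_eq_true]
  constructor
  · rintro ⟨x, hx, hbit⟩
    obtain ⟨j, hj, rfl⟩ := (mem_toList_iff pts x).1 hx
    rw [testBit_supT m (hpts j hj), decide_eq_true hy, Bool.true_and, sub_eq_true_iff _ (hpts j hj)] at hbit
    exact ⟨j, hj, hbit⟩
  · rintro ⟨j, hj, hsub⟩
    refine ⟨pts.getD j 0, (mem_toList_iff pts _).2 ⟨j, hj, rfl⟩, ?_⟩
    rw [testBit_supT m (hpts j hj), decide_eq_true hy, Bool.true_and, sub_eq_true_iff _ (hpts j hj)]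
    exact hsub

/-- A set bit of `upNOf` is a code `< 2^m`. [this work] -/
theorem lt_of_testBit_upNOf {pts : Array ℕ} (hpts : PtsLt m pts) {y : ℕ} (h : (upNOf m pts).testBit y = true) : y < 2 ^ m := by
  unfold upNOf at h
  rw [orTab_eq_pair43, testBit_orTab, List.any_eq_true] at h
  obtain ⟨x, hx, hbit⟩ := h
  obtain ⟨j, hj, rfl⟩ := (mem_toList_iff pts x).1 hx
  rw [testBit_supT m (hpts j hj)] at hbit
  by_contra hy
  rw [decide_eq_false hy] at hbit
  simp at hbit

/-- **THE MINIMAL-ELEMENT FILTER WORD VANISHES FOR A CONDITIONED PAIR.** [this work] -/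
theorem filter₂_eq_zero {A B : Finset (Set (Fin m))} {pts : Array ℕ} {mm : ℕ} (hR : Repr m A B pts mm) (hAB : PairSat.PairCond A B) :
    ((minMask (mkTabs m) (cU m pts mm) &&& cV m pts mm) ||| (minMask (mkTabs m) (cV m pts mm) &&& cU m pts mm)) &&& upNOf m pts = 0 := by
  refine Nat.eq_of_testBit_eq fun y => ?_
  rw [Nat.zero_testBit, Nat.testBit_land, Nat.testBit_lor, Nat.testBit_land, Nat.testBit_land, cU_eq_encA hR hAB.upA, cV_eq_encA hR hAB.upB]
  cases hN : (upNOf m pts).testBit y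
  · simp
  · have hy : y < 2 ^ m := lt_of_testBit_upNOf hR.lt hN
    obtain ⟨j, hj, hsub⟩ := (testBit_upNOf_iff hR.lt hy).1 hN
    have hz : pt m (pts.getD j 0) ∈ PairSat.coGen A ∪ PairSat.coGen B := (hR.mem_union_iff _).2 ⟨j, hj, rfl⟩
    have key : ∀ {X Y : Finset (Set (Fin m))}, IsUpperSet (X : Set (Set (Fin m))) →
        (∀ q ∈ PairSat.minEl X, q ∈ Y → PairSat.Free (PairSat.coGen A ∪ PairSat.coGen B) q) →
        ((minMask (mkTabs m) (encA m ↑X)).testBit y && (encA m (↑Y : Set (Set (Fin m)))).testBit y) = false := by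
      intro X Y hX hmin
      by_contra hne
      rw [Bool.not_eq_false, Bool.and_eq_true] at hne
      have hmX := mem_minEl_of_testBit_minMask hX hy hne.1
      have hyY : pt m y ∈ Y := by
        have := hne.2; rw [testBit_encA_of_lt _ hy] at this; exact @of_decide_eq_true _ (Classical.propDecidable _) this
      exact ((hmin _ hmX hyY) _ hz).2 hsub
    rw [key hAB.upA hAB.minA, key hAB.upB hAB.minB]
    simp

/-! ### `passes` -/

/-- The four facts give `passes = true`. [this work] -/
theorem passes_of (T : Tabs) (pts K : Array ℕ) (cb upN mm : ℕ) (h1 : ¬ cb < countBelow pts.size fun j => inFirst mm j)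
    (h2 : ¬ cb < pts.size - countBelow pts.size fun j => inFirst mm j)
    (h3 : ((minMask T (T.full ^^^ (classDown T pts mm).1) &&& (T.full ^^^ (classDown T pts mm).2)) |||
      (minMask T (T.full ^^^ (classDown T pts mm).2) &&& (T.full ^^^ (classDown T pts mm).1))) &&& upN = 0)
    (h4 : tieOk T pts K mm = true) : passes T pts K cb upN mm = true := by
  unfold passes
  simp only [h1, h2, decide_false, Bool.or_false, Bool.false_eq_true, ↓reduceIte, h3, h4]
  simp

end Summit.CriticalPhenomena.PercolationContinuityZ3.Theorems.ThreePartition.Cube
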